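import Summits.CriticalPhenomena.SAWScalingLimit.Theorems.SAWRenewalTightnessTubeLowerBoundDefs
import Literature.Probability.Percolation.LatticeSymmetry

/-!
# Crux `TubeLowerBound` (stmt-CriticalPhenomena-4730), line `lieb-simon-star`: stub `quarterFlux`

The unconditional Simon–Lieb half of the line, PROVED outright (no named facts, no new definitions):

* `liebSimonFloor : LiebSimonFloor` — for `R ≥ 1` the `x_c`-mass of the first-exit walks of the
  open box `‖·‖∞ < R` is `≥ 1` (the Lieb–Simon inequality run backwards at criticality; Madras–Slade
  1993, Lemma A.1; Simon 1980; Lieb 1980): an `n`-step SAW, `n ≥ (2R−1)²`, leaves the box (it has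
  `(2R−1)²` sites); cutting at the first exit gives `c_n ≤ Σ_{(k,π)} c_{n−k}` over the first-exit
  walks `π` of length `k` (`LiebSimon.count_le_cut`); were their mass `θ = Σ x_c^k < 1`, this
  renewal inequality would force `c_n x_c^n → 0` (`LiebSimon.renewal_floor`), against `μ^n ≤ c_n`.
* `stub_quarterFlux : QuarterFlux` — a quarter of that mass exits through the east side `x = R`
  (the exit point lies on one of four sides; `s ↦ −s`, the transposition `(a,b) ↦ (b,a)` and
  `(a,b) ↦ (−b,−a)` map the west/north/south families injectively into the east family,
  `LiebSimon.card_le_four_mul`).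

The helpers (sub-namespace `LiebSimon`) are stated for abstract families `X k` / `E k` of
first-exit / east-exit walks of length `k`, characterised by the membership hypotheses `hX` / `hE`;
the two final theorems instantiate them with the `Finset.filter`s of the Defs file.
-/

noncomputable section

namespace Summit.CriticalPhenomena.SAWScalingLimit.Theorems.TubeLowerBound.LiebSimonStar

open scoped BigOperators Classical
open Literature.Probability.LatticeModels
open Literature.Probability.RandomPlanarGeometry Literature.Probability.RandomPlanarGeometry.SAW
open Literature.Probability.Percolation (transposeIso transposeIso_apply_zero)

namespace LiebSimon

/-- `‖0‖∞ = 0`. -/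
theorem supNorm_zero : supNorm (0 : Site 2) = 0 := by simp [supNorm]

/-- `‖−s‖∞ = ‖s‖∞`. -/
theorem supNorm_neg (s : Site 2) : supNorm (-s) = supNorm s := by simp [supNorm]

/-- `‖(b, a)‖∞ = ‖(a, b)‖∞`. -/
theorem supNorm_transpose (s : Site 2) : supNorm (transposeIso s) = supNorm s := by
  simp [supNorm, max_comm]

/-- One lattice step raises the sup-norm by at most one. -/
theorem supNorm_le_of_adj {x y : Site 2} (h : (zdGraph 2).Adj x y) : supNorm y ≤ supNorm x + 1 := by
  have h0 := Zd.abs_sub_le_one_of_adj h 0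
  have h1 := Zd.abs_sub_le_one_of_adj h 1
  simp only [supNorm, abs_eq_max_neg] at h0 h1 ⊢
  omega

/-- **First exit.** For `R ≥ 1` and an `n`-step self-avoiding walk `ω`, `n ≥ (2R−1)²`, let `k` be
the first time with `‖ω k‖∞ ≥ R` or `k ≥ n`.  Then `1 ≤ k ≤ (2R−1)²` (pigeonhole: the open box
`‖·‖∞ < R` has `(2R−1)²` sites), `ω` is inside the open box before `k`, and EXACTLY on `‖·‖∞ = R` at
time `k` (one step changes the sup-norm by at most one). -/
theorem find_exit_props {R n : ℕ} {ω : ℕ → Site 2} (hR : 1 ≤ R) (hn : (2 * R - 1) ^ 2 ≤ n)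
    (hω : ω ∈ Zd.saws 2 n) (hex : ∃ i, (R : ℤ) ≤ supNorm (ω i) ∨ n ≤ i) :
    1 ≤ Nat.find hex ∧ Nat.find hex ≤ (2 * R - 1) ^ 2 ∧
      (∀ i < Nat.find hex, supNorm (ω i) < (R : ℤ)) ∧ supNorm (ω (Nat.find hex)) = (R : ℤ) := by
  obtain ⟨h0, -, hadj, hinj⟩ := Zd.mem_saws.1 hω
  obtain ⟨i, hiM, hi⟩ : ∃ i ≤ (2 * R - 1) ^ 2, (R : ℤ) ≤ supNorm (ω i) := by
    by_contra hcon
    push Not at hcon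
    have hle := Finset.card_le_card_of_injOn ω (s := Finset.range ((2 * R - 1) ^ 2 + 1))
      (t := Fintype.piFinset fun _ : Fin 2 => Finset.Ioo (-(R : ℤ)) R) (fun i hi => ?_)
      (fun i hi j hj hij => ?_)
    · rw [Finset.card_range, Fintype.card_piFinset_const, Int.card_Ioo,
        show ((R : ℤ) - -(R : ℤ) - 1).toNat = 2 * R - 1 by omega] at hle
      exact Nat.not_succ_le_self _ hle
    · rw [Finset.coe_range, Set.mem_Iio] at hi
      have h := hcon i (Nat.lt_succ_iff.1 hi)
      rw [Finset.mem_coe, Fintype.mem_piFinset, Fin.forall_fin_two, Finset.mem_Ioo, Finset.mem_Ioo]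
      simp only [supNorm, abs_eq_max_neg] at h
      omega
    · rw [Finset.coe_range, Set.mem_Iio] at hi hj
      exact hinj (by simp only [Set.mem_setOf_eq]; omega) (by simp only [Set.mem_setOf_eq]; omega)
        hij
  generalize (2 * R - 1) ^ 2 = M at hiM hn ⊢
  have hki : Nat.find hex ≤ i := Nat.find_min' hex (Or.inl hi)
  have hbefore : ∀ j < Nat.find hex, supNorm (ω j) < R := fun j hj =>
    lt_of_not_ge fun hge => Nat.find_min hex hj (Or.inl hge)
  have hspec : (R : ℤ) ≤ supNorm (ω (Nat.find hex)) := by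
    rcases Nat.find_spec hex with h | h
    · exact h
    · rw [show Nat.find hex = i by omega]
      exact hi
  have hk1 : 1 ≤ Nat.find hex := Nat.pos_of_ne_zero fun hk => by
    rw [hk, h0, supNorm_zero] at hspec; omega
  refine ⟨hk1, hki.trans hiM, hbefore, le_antisymm ?_ hspec⟩
  have hprev : supNorm (ω (Nat.find hex - 1)) < R := hbefore _ (by omega)
  have hstep := supNorm_le_of_adj (hadj (Nat.find hex - 1) (by omega))
  rw [Nat.sub_add_cancel hk1] at hstep
  omega

/-- The first `k ≤ n` steps of an `n`-step self-avoiding walk, frozen at time `k`, form a `k`-step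
self-avoiding walk. -/
theorem prefix_mem_saws {d n k : ℕ} {ω : ℕ → Site d} (hk : k ≤ n) (hω : ω ∈ Zd.saws d n) :
    (fun i => ω (min i k)) ∈ Zd.saws d k := by
  -- adapted from `SAW.Zd.count_add_le` (SAWCount.lean)
  obtain ⟨h0, -, hadj, hinj⟩ := Zd.mem_saws.1 hω
  refine Zd.mem_saws.2 ⟨by simpa using h0, fun i hi => by simp [min_eq_right hi], fun i hi => ?_,
    fun i hi j hj hij => ?_⟩
  · have h1 : min i k = i := min_eq_left hi.le
    have h2 : min (i + 1) k = i + 1 := min_eq_left (by omega)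
    simp only [h1, h2]
    exact hadj i (by omega)
  · simp only [Set.mem_setOf_eq] at hi hj
    simp only [min_eq_left hi, min_eq_left hj] at hij
    exact hinj (by simp only [Set.mem_setOf_eq]; omega) (by simp only [Set.mem_setOf_eq]; omega) hij

/-- The last `n − k` steps of an `n`-step self-avoiding walk, translated back to the origin and
frozen, form an `(n − k)`-step self-avoiding walk. -/
theorem suffix_mem_saws {d n k : ℕ} {ω : ℕ → Site d} (hk : k ≤ n) (hω : ω ∈ Zd.saws d n) :
    (fun j => ω (k + min j (n - k)) - ω k) ∈ Zd.saws d (n - k) := by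
  -- adapted from `SAW.Zd.count_add_le` (SAWCount.lean)
  obtain ⟨-, -, hadj, hinj⟩ := Zd.mem_saws.1 hω
  refine Zd.mem_saws.2 ⟨by simp, fun i hi => by simp [min_eq_right hi], fun i hi => ?_,
    fun i hi j hj hij => ?_⟩
  · have h1 : min i (n - k) = i := min_eq_left hi.le
    have h2 : min (i + 1) (n - k) = i + 1 := min_eq_left (by omega)
    simp only [h1, h2]
    rw [Zd.zdGraph_adj_sub_right, ← add_assoc]
    exact hadj (k + i) (by omega)
  · simp only [Set.mem_setOf_eq] at hi hj
    simp only [min_eq_left hi, min_eq_left hj, sub_left_inj] at hij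
    have := hinj (by simp only [Set.mem_setOf_eq]; omega) (by simp only [Set.mem_setOf_eq]; omega)
      hij
    omega

/-- `c_n x_c^n ≥ 1`, i.e. `μ^n ≤ c_n`. -/
theorem one_le_weightedCount (n : ℕ) : 1 ≤ (Zd.count 2 n : ℝ) * criticalFugacity ^ n := by
  rw [show criticalFugacity = (Zd.connectiveConstant 2)⁻¹ from rfl, inv_pow, ← div_eq_mul_inv,
    le_div_iff₀ (pow_pos (Zd.connectiveConstant_pos 2) n), one_mul]
  exact Zd.pow_connectiveConstant_le_count 2 n

/-- **Abstract renewal decay.** If `a_m ≤ B` (`B ≥ 0`) for `m < M`, `M ≥ 1`, and for `n ≥ M`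
`a_n ≤ Σ_{i ∈ F} w_i a_{n − ℓ_i}` with `w ≥ 0`, `1 ≤ ℓ_i ≤ M` and `θ = Σ w_i ≤ 1`, then
`a_n ≤ θ^{⌊n/M⌋} B`. -/
theorem renewal_decay {ι : Type*} {F : Finset ι} {len : ι → ℕ} {w : ι → ℝ} {a : ℕ → ℝ} {M : ℕ}
    {θ B : ℝ} (hM : 1 ≤ M) (hlen : ∀ i ∈ F, 1 ≤ len i ∧ len i ≤ M) (hw : ∀ i ∈ F, 0 ≤ w i)
    (hrec : ∀ n, M ≤ n → a n ≤ ∑ i ∈ F, w i * a (n - len i))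
    (hθ : ∑ i ∈ F, w i = θ) (hθ1 : θ ≤ 1) (hB : ∀ m < M, a m ≤ B) (hB0 : 0 ≤ B) (n : ℕ) :
    a n ≤ θ ^ (n / M) * B := by
  have hθ0 : 0 ≤ θ := hθ ▸ Finset.sum_nonneg hw
  induction n using Nat.strong_induction_on with
  | _ n ih =>
    rcases lt_or_ge n M with hnM | hMn
    · rw [Nat.div_eq_of_lt hnM, pow_zero, one_mul]
      exact hB n hnM
    · have h1 : 1 ≤ n / M := Nat.div_pos hMn hM
      calc a n ≤ ∑ i ∈ F, w i * a (n - len i) := hrec n hMn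
        _ ≤ ∑ i ∈ F, w i * (θ ^ (n / M - 1) * B) := by
          refine Finset.sum_le_sum fun i hi => mul_le_mul_of_nonneg_left ?_ (hw i hi)
          obtain ⟨hl1, hlM⟩ := hlen i hi
          refine (ih _ (by omega)).trans (mul_le_mul_of_nonneg_right ?_ hB0)
          refine pow_le_pow_of_le_one hθ0 hθ1 ?_
          calc n / M - 1 = (n - M * 1) / M := (Nat.sub_mul_div n M 1).symm
            _ ≤ (n - len i) / M := Nat.div_le_div_right (by omega)
        _ = θ ^ (n / M) * B := by
          rw [← Finset.sum_mul, hθ, ← mul_assoc, ← pow_succ', Nat.sub_add_cancel h1]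

/-- **Abstract renewal floor.** If `a_n ≥ 1` for all `n` and, for `n ≥ M ≥ 1`,
`a_n ≤ Σ_{i ∈ F} w_i a_{n − ℓ_i}` with `w ≥ 0` and `1 ≤ ℓ_i ≤ M`, then `Σ w_i ≥ 1`
(otherwise `1 ≤ a_{jM} ≤ θ^j B → 0`). -/
theorem renewal_floor {ι : Type*} (F : Finset ι) (len : ι → ℕ) (w : ι → ℝ) (a : ℕ → ℝ) {M : ℕ}
    (hM : 1 ≤ M) (hlen : ∀ i ∈ F, 1 ≤ len i ∧ len i ≤ M) (hw : ∀ i ∈ F, 0 ≤ w i)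
    (ha : ∀ n, 1 ≤ a n) (hrec : ∀ n, M ≤ n → a n ≤ ∑ i ∈ F, w i * a (n - len i)) :
    1 ≤ ∑ i ∈ F, w i := by
  by_contra hθ
  push Not at hθ
  have ha0 : ∀ n, 0 ≤ a n := fun n => zero_le_one.trans (ha n)
  have hB : ∀ m < M, a m ≤ ∑ m ∈ Finset.range M, a m := fun m hm =>
    Finset.single_le_sum (fun m _ => ha0 m) (Finset.mem_range.2 hm)
  have hB0 : 0 < ∑ m ∈ Finset.range M, a m := one_pos.trans_le ((ha 0).trans (hB 0 hM))
  obtain ⟨j, hj⟩ := exists_pow_lt_of_lt_one (inv_pos.2 hB0) hθ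
  have h2 := renewal_decay hM hlen hw hrec rfl hθ.le hB hB0.le (j * M)
  rw [Nat.mul_div_cancel _ hM] at h2
  have h3 := mul_lt_mul_of_pos_right hj hB0
  rw [inv_mul_cancel₀ hB0.ne'] at h3
  linarith [ha (j * M)]

/-- A finset covered by four predicates is no larger than the sum of the four filtered parts. -/
theorem card_le_of_cover₄ {α : Type*} (s : Finset α) (P₁ P₂ P₃ P₄ : α → Prop) [DecidablePred P₁]
    [DecidablePred P₂] [DecidablePred P₃] [DecidablePred P₄]
    (h : ∀ x ∈ s, P₁ x ∨ P₂ x ∨ P₃ x ∨ P₄ x) :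
    s.card ≤ (s.filter P₁).card + (s.filter P₂).card + (s.filter P₃).card + (s.filter P₄).card := by
  rw [Finset.card_filter, Finset.card_filter, Finset.card_filter, Finset.card_filter,
    ← Finset.sum_add_distrib, ← Finset.sum_add_distrib, ← Finset.sum_add_distrib,
    Finset.card_eq_sum_ones]
  refine Finset.sum_le_sum fun x hx => ?_
  rcases h x hx with h | h | h | h <;> simp only [h, if_true] <;> omega

section Families

/-! ### The first-exit family `X` and the east-exit family `E`, abstractly -/

variable {R : ℕ} {X E : ℕ → Finset (ℕ → Site 2)}
  (hX : ∀ k ω, ω ∈ X k ↔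
    ω ∈ Zd.saws 2 k ∧ (∀ i < k, supNorm (ω i) < (R : ℤ)) ∧ supNorm (ω k) = (R : ℤ))
  (hE : ∀ k ω, ω ∈ E k ↔ ω ∈ Zd.saws 2 k ∧ (∀ i < k, supNorm (ω i) < (R : ℤ)) ∧ ω k 0 = (R : ℤ))

include hX

/-- Pairs `(k, π)`, `π` a first-exit walk of length `k ≤ (2R−1)²`, have `1 ≤ k` once `R ≥ 1`. -/
theorem fst_mem_pairs (hR : 1 ≤ R) {kp : Σ _ : ℕ, ℕ → Site 2}
    (h : kp ∈ (Finset.range ((2 * R - 1) ^ 2 + 1)).sigma X) :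
    1 ≤ kp.1 ∧ kp.1 ≤ (2 * R - 1) ^ 2 := by
  rw [Finset.mem_sigma, Finset.mem_range, hX] at h
  obtain ⟨hk, hω, -, hat⟩ := h
  refine ⟨?_, Nat.lt_succ_iff.1 hk⟩
  by_contra h0
  rw [show kp.1 = 0 by omega, (Zd.mem_saws.1 hω).1, supNorm_zero] at hat
  omega

/-- **The Lieb–Simon cut.** For `R ≥ 1` and `n ≥ (2R−1)²`: `c_n ≤ Σ_{(k,π)} c_{n−k}` over the
first-exit walks `π` of length `k ≤ (2R−1)²` — cutting at the first exit (`find_exit_props`) is an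
injection of the `n`-step self-avoiding walks into the pairs (first-exit walk of length `k`,
`(n−k)`-step walk). -/
theorem count_le_cut (hR : 1 ≤ R) {n : ℕ} (hn : (2 * R - 1) ^ 2 ≤ n) :
    Zd.count 2 n ≤
      ∑ kp ∈ (Finset.range ((2 * R - 1) ^ 2 + 1)).sigma X, Zd.count 2 (n - kp.1) := by
  -- adapted from `SAW.Zd.count_add_le` (SAWCount.lean)
  have hex : ∀ ω : ℕ → Site 2, ∃ i, (R : ℤ) ≤ supNorm (ω i) ∨ n ≤ i := fun ω => ⟨n, Or.inr le_rfl⟩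
  calc Zd.count 2 n = (Zd.saws 2 n).card := (Zd.card_saws 2 n).symm
    _ ≤ (((Finset.range ((2 * R - 1) ^ 2 + 1)).sigma X).sigma
          fun kp => Zd.saws 2 (n - kp.1)).card :=
        Finset.card_le_card_of_injOn
          (fun ω => (⟨⟨Nat.find (hex ω), fun i => ω (min i (Nat.find (hex ω)))⟩, fun j =>
            ω (Nat.find (hex ω) + min j (n - Nat.find (hex ω))) - ω (Nat.find (hex ω))⟩ :
              Σ _ : (Σ _ : ℕ, ℕ → Site 2), ℕ → Site 2))
          (fun ω hω => ?_) (fun ω hω ω' hω' h => ?_)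
    _ = ∑ kp ∈ (Finset.range ((2 * R - 1) ^ 2 + 1)).sigma X, Zd.count 2 (n - kp.1) := by
        rw [Finset.card_sigma]
        exact Finset.sum_congr rfl fun kp _ => Zd.card_saws 2 _
  · rw [Finset.mem_coe] at hω
    obtain ⟨-, hkM, hbefore, hat⟩ := find_exit_props hR hn hω (hex ω)
    simp only [Finset.mem_coe, Finset.mem_sigma, Finset.mem_range, hX]
    generalize Nat.find (hex ω) = k at hkM hbefore hat ⊢
    have hkn : k ≤ n := hkM.trans hn
    refine ⟨⟨Nat.lt_succ_of_le hkM, prefix_mem_saws hkn hω, fun i hi => ?_, ?_⟩,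
      suffix_mem_saws hkn hω⟩
    · rw [min_eq_left hi.le]
      exact hbefore i hi
    · rw [min_self]
      exact hat
  · rw [Finset.mem_coe] at hω hω'
    have hkn : Nat.find (hex ω) ≤ n := (find_exit_props hR hn hω (hex ω)).2.1.trans hn
    have hfro := (Zd.mem_saws.1 hω).2.1
    have hfro' := (Zd.mem_saws.1 hω').2.1
    simp only [Sigma.mk.injEq, heq_eq_eq] at h
    obtain ⟨⟨hk, hπ⟩, hυ⟩ := h
    rw [← hk] at hπ hυ
    generalize Nat.find (hex ω) = k at hkn hπ hυ
    have hkk : ω k = ω' k := by simpa using congrFun hπ k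
    funext i
    rcases le_or_gt i k with hi | hi
    · simpa [min_eq_left hi] using congrFun hπ i
    · obtain ⟨j, rfl⟩ : ∃ j, i = k + j := ⟨i - k, by omega⟩
      rcases le_or_gt j (n - k) with hj | hj
      · have := congrFun hυ j
        simp only [min_eq_left hj] at this
        rwa [hkk, sub_left_inj] at this
      · have := congrFun hυ (n - k)
        simp only [min_self] at this
        rw [hkk, sub_left_inj, Nat.add_sub_of_le hkn] at this
        rw [hfro (k + j) (by omega), hfro' (k + j) (by omega), this]

/-- The weighted cut `c_n x_c^n ≤ Σ_{(k,π)} x_c^k · (c_{n−k} x_c^{n−k})` for `n ≥ (2R−1)²`. -/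
theorem weighted_cut (hR : 1 ≤ R) {n : ℕ} (hn : (2 * R - 1) ^ 2 ≤ n) :
    (Zd.count 2 n : ℝ) * criticalFugacity ^ n ≤ ∑ kp ∈ (Finset.range ((2 * R - 1) ^ 2 + 1)).sigma X,
      criticalFugacity ^ kp.1 * ((Zd.count 2 (n - kp.1) : ℝ) * criticalFugacity ^ (n - kp.1)) := by
  have h' : (Zd.count 2 n : ℝ) ≤
      ∑ kp ∈ (Finset.range ((2 * R - 1) ^ 2 + 1)).sigma X, (Zd.count 2 (n - kp.1) : ℝ) := by
    exact_mod_cast count_le_cut hX hR hn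
  refine (mul_le_mul_of_nonneg_right h' (pow_nonneg criticalFugacity_pos.le n)).trans_eq ?_
  rw [Finset.sum_mul]
  refine Finset.sum_congr rfl fun kp hkp => ?_
  have : criticalFugacity ^ n = criticalFugacity ^ kp.1 * criticalFugacity ^ (n - kp.1) := by
    rw [← pow_add, Nat.add_sub_of_le ((fst_mem_pairs hX hR hkp).2.trans hn)]
  rw [this]
  ring

/-- **Lieb–Simon floor for the abstract family:** the `x_c`-mass of the first-exit walks of length
`≤ (2R−1)²` is `≥ 1` (`renewal_floor` fed with `weighted_cut` and `μ^n ≤ c_n`). -/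
theorem one_le_exitMass (hR : 1 ≤ R) :
    (1 : ℝ) ≤ ∑ n ∈ Finset.range ((2 * R - 1) ^ 2 + 1), ∑ _ω ∈ X n, criticalFugacity ^ n := by
  have hsum : ∑ kp ∈ (Finset.range ((2 * R - 1) ^ 2 + 1)).sigma X, criticalFugacity ^ kp.1 =
      ∑ n ∈ Finset.range ((2 * R - 1) ^ 2 + 1), ∑ _ω ∈ X n, criticalFugacity ^ n :=
    Finset.sum_sigma _ _ _
  rw [← hsum]
  exact renewal_floor _ (fun kp => kp.1) (fun kp => criticalFugacity ^ kp.1)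
    (fun n => (Zd.count 2 n : ℝ) * criticalFugacity ^ n) (M := (2 * R - 1) ^ 2)
    (Nat.one_le_pow _ _ (by omega)) (fun kp hkp => fst_mem_pairs hX hR hkp)
    (fun kp _ => pow_nonneg criticalFugacity_pos.le _) one_le_weightedCount
    fun n hn => weighted_cut hX hR hn

include hE

/-- Transport to the east side: if `g` fixes `0`, is injective and preserves adjacency and the
sup-norm, then the first-exit walks of length `k` whose exit point `g` sends to the east side
`x = R` are no more than the east-exit walks (`ω ↦ g ∘ ω` is an injection). -/
theorem card_filter_le_east {g : Site 2 → Site 2} (hg0 : g 0 = 0) (hginj : Function.Injective g)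
    (hgadj : ∀ x y, (zdGraph 2).Adj x y → (zdGraph 2).Adj (g x) (g y))
    (hgnorm : ∀ s, supNorm (g s) = supNorm s) {k : ℕ} {P : (ℕ → Site 2) → Prop} [DecidablePred P]
    (hP : ∀ ω, P ω → g (ω k) 0 = (R : ℤ)) : ((X k).filter P).card ≤ (E k).card := by
  refine Finset.card_le_card_of_injOn (fun ω i => g (ω i)) (fun ω hω => ?_) (fun ω _ ω' _ h => ?_)
  · rw [Finset.mem_coe, Finset.mem_filter, hX] at hω
    obtain ⟨⟨hω, hbefore, -⟩, hPω⟩ := hω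
    obtain ⟨h0, hend, hadj, hinj⟩ := Zd.mem_saws.1 hω
    rw [Finset.mem_coe, hE]
    refine ⟨Zd.mem_saws.2 ⟨by simp [h0, hg0], fun i hi => by simp [hend i hi],
      fun i hi => hgadj _ _ (hadj i hi), fun i hi j hj hij => hinj hi hj (hginj hij)⟩,
      fun i hi => by rw [hgnorm]; exact hbefore i hi, hP ω hPω⟩
  · funext i
    exact hginj (congrFun h i)

/-- **East share.** At every length the first-exit family is at most four times the east-exit
family: the exit point lies on one of the four sides of the box, and `s ↦ −s`, the transposition
`(a,b) ↦ (b,a)` and `(a,b) ↦ (−b,−a)` map the west, north and south parts injectively into the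
east-exit family. -/
theorem card_le_four_mul (k : ℕ) : (X k).card ≤ 4 * (E k).card := by
  have h0 := card_le_of_cover₄ (X k) (fun ω => ω k 0 = (R : ℤ)) (fun ω => ω k 0 = -(R : ℤ))
    (fun ω => ω k 1 = (R : ℤ)) (fun ω => ω k 1 = -(R : ℤ)) fun ω hω => by
      have hat := ((hX k ω).1 hω).2.2
      simp only [supNorm, abs_eq_max_neg] at hat
      show ω k 0 = (R : ℤ) ∨ ω k 0 = -(R : ℤ) ∨ ω k 1 = (R : ℤ) ∨ ω k 1 = -(R : ℤ)
      omega
  have h1 := card_filter_le_east hX hE (k := k) (P := fun ω => ω k 0 = (R : ℤ)) (g := id) rfl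
    Function.injective_id (fun _ _ h => h) (fun _ => rfl) fun ω h => h
  have h2 := card_filter_le_east hX hE (k := k) (P := fun ω => ω k 0 = -(R : ℤ)) (g := fun s => -s)
    neg_zero neg_injective (fun x y h => (Zd.zdGraph_adj_neg x y).2 h) supNorm_neg
    fun ω (h : ω k 0 = -(R : ℤ)) => show -(ω k 0) = (R : ℤ) by omega
  have h3 := card_filter_le_east hX hE (k := k) (P := fun ω => ω k 1 = (R : ℤ)) (g := transposeIso)
    (show transposeIso 0 = (0 : Site 2) by funext i; fin_cases i <;> simp) transposeIso.injective
    (fun x y h => transposeIso.map_adj_iff.2 h) supNorm_transpose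
    fun ω (h : ω k 1 = (R : ℤ)) => show transposeIso (ω k) 0 = (R : ℤ) by
      rw [transposeIso_apply_zero]; exact h
  have h4 := card_filter_le_east hX hE (k := k) (P := fun ω => ω k 1 = -(R : ℤ))
    (g := fun s => -transposeIso s)
    (show -transposeIso 0 = (0 : Site 2) by rw [neg_eq_zero]; funext i; fin_cases i <;> simp)
    (neg_injective.comp transposeIso.injective)
    (fun x y h => (Zd.zdGraph_adj_neg _ _).2 (transposeIso.map_adj_iff.2 h))
    (fun s => by rw [supNorm_neg, supNorm_transpose])
    fun ω (h : ω k 1 = -(R : ℤ)) => show (-transposeIso (ω k)) 0 = (R : ℤ) by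
      rw [Pi.neg_apply, transposeIso_apply_zero]; omega
  omega

/-- The `x_c`-mass of the first-exit family is at most four times that of the east-exit family. -/
theorem exitMass_le_four_mul (N : ℕ) :
    ∑ n ∈ Finset.range N, ∑ _ω ∈ X n, criticalFugacity ^ n ≤
      4 * ∑ n ∈ Finset.range N, ∑ _ω ∈ E n, criticalFugacity ^ n := by
  rw [Finset.mul_sum]
  refine Finset.sum_le_sum fun n _ => ?_
  rw [Finset.sum_const, Finset.sum_const, nsmul_eq_mul, nsmul_eq_mul, ← mul_assoc]
  refine mul_le_mul_of_nonneg_right ?_ (pow_nonneg criticalFugacity_pos.le n)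
  exact_mod_cast card_le_four_mul hX hE n

end Families

end LiebSimon

/-- **`LiebSimonFloor`** (the Lieb–Simon inequality run backwards at criticality): for every
`R ≥ 1` the `x_c`-mass of the first-exit walks of the open box `‖·‖∞ < R` is at least `1`. -/
theorem liebSimonFloor : LiebSimonFloor := fun R hR =>
  LiebSimon.one_le_exitMass (X := fun k => (Zd.saws 2 k).filter fun ω =>
    (∀ i < k, supNorm (ω i) < (R : ℤ)) ∧ supNorm (ω k) = (R : ℤ)) (fun _ _ => Finset.mem_filter) hR

/-- **`QuarterFlux`** (registered stub `stub_quarterFlux` of the line `lieb-simon-star`): for every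
`R ≥ 1` the first-exit walks of the open `R`-box leaving through the east side `x = R` carry
`x_c`-mass at least `1/4` — `LiebSimonFloor` and the order-4 symmetry of the box. -/
theorem stub_quarterFlux : QuarterFlux := by
  intro R hR
  have h1 := liebSimonFloor R hR
  have h4 := LiebSimon.exitMass_le_four_mul
    (X := fun k => (Zd.saws 2 k).filter fun ω =>
      (∀ i < k, supNorm (ω i) < (R : ℤ)) ∧ supNorm (ω k) = (R : ℤ))
    (E := fun k => (Zd.saws 2 k).filter fun ω =>
      (∀ i < k, supNorm (ω i) < (R : ℤ)) ∧ ω k 0 = (R : ℤ))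
    (fun _ _ => Finset.mem_filter) (fun _ _ => Finset.mem_filter) ((2 * R - 1) ^ 2 + 1)
  show (1 : ℝ) / 4 ≤ ∑ n ∈ Finset.range ((2 * R - 1) ^ 2 + 1), ∑ _ω ∈ (Zd.saws 2 n).filter
    (fun ω => (∀ i < n, supNorm (ω i) < (R : ℤ)) ∧ ω n 0 = (R : ℤ)), criticalFugacity ^ n
  linarith

end Summit.CriticalPhenomena.SAWScalingLimit.Theorems.TubeLowerBound.LiebSimonStar

end
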